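import Summits.Parity.GeneralizedHardyLittlewood.Theorems.ChenParityOracleBLAPParityOracleChenTools
import HarnessLib

/-!
# Route `ChenParityOracleBLAP` — crux `ParityOracleChen` (stmt-Parity-20046): estimate (B′)

Support file 3/5: the UPPER bound `∑_{x^{1/8} ≤ q < (x+3)^{1/3}} S(𝒜′(x)_q, x^{1/8}) ≤ (e^γ log 6/4 + ε)(x/log x)V(x^{1/8})`
for the parity subset `𝒜′(x)` of Chen's twin sequence, under the oracle hypothesis (HP1 form)
`∑_{d ≤ x^{1/2−ε}} |∑_{n ∈ 𝒜(x), d∣n} λ(n)| = o(x/(log x)²)`. This is the tree's PROVED estimate (B)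
`Literature.NumberTheory.Sieve.Chen.twin_sieveUpperSum_holds` (Nathanson Thm 10.5 for `{p + 2}`) with the
main term halved: the tree's proof verbatim, each `𝒜_q` being sifted by the twisted upper bound
`Iwaniec1980_twisted_upper_of_half_lt` (`b = ½1_{𝒜_q}(1 − λ)`, `e = 1_{𝒜_q}λ`), and the oracle
remainders `∑_q ∑_{d < x^{1/2−h}/q} |Λ_{qd}|` rearranged to `≤ ∑_{m ≤ x^{1/2−h}} |Λ_m|`.

References: [Nathanson1996] Thm 10.5; [ChenSciSinica1973] p. 176; [IwaniecActaArith1980] Thm 1.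
-/

namespace Summit.Parity.GeneralizedHardyLittlewood.Theorems

open Finset Filter Topology
open scoped ArithmeticFunction.Moebius ArithmeticFunction.Omega
open Literature.NumberTheory.Sieve Literature.NumberTheory.Sieve.Chen
  Literature.NumberTheory.Sieve.ChenSieve Literature.NumberTheory.Sieve.SieveSequence

set_option maxHeartbeats 1600000 in
/-- **(B′) The upper bound for the parity subsets of the `𝒜_q`, under the oracle hypothesis.**
Suppose that for every `ε, η > 0` and all large `x`, `∑_{d ≤ x^{1/2−ε}} |∑_{n ∈ 𝒜(x), d ∣ n} λ(n)| ≤ η x/(log x)²`.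
Then for every `ε > 0` and all large `x`,
`∑_{x^{1/8} ≤ q < (x+3)^{1/3}, q prime} S(𝒜′(x)_q, x^{1/8}) ≤ (e^γ log 6/4 + ε)(x/log x) V(x^{1/8})`,
`𝒜′(x) = {n ∈ 𝒜(x) : λ(n) = −1}` — Nathanson's Theorem 10.5 for `{p + 2}` (the tree's
`Chen.twin_sieveUpperSum_holds`) with the main term HALVED. Proof: the tree's proof verbatim, with
Iwaniec's upper bound for each `𝒜_q` (level `x^{1/2−h}/q`) replaced by its twisted form
`Iwaniec1980_twisted_upper_of_half_lt` (`b = ½ 1_{𝒜_q}(1 − λ)`, `e = 1_{𝒜_q} λ`); the oracle remainders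
`½ ∑_{d < x^{1/2−h}/q} |Λ_{qd}|` rearrange (`(q, d) ↦ qd` injective) to `≤ ½ ∑_{m ≤ x^{1/2−h}} |Λ_m|`, which
is `≤ ε/4 · X V` by hypothesis. -/
theorem parity_twin_sieveUpperSum
    (hΛ : ∀ ε : ℝ, 0 < ε → ∀ η : ℝ, 0 < η → ∀ᶠ x : ℕ in atTop,
      (∑ d ∈ Finset.Icc 1 ⌊(x : ℝ) ^ (1 / 2 - ε)⌋₊,
        |∑ n ∈ (twinSieveSet x).filter (fun n => d ∣ n), (ArithmeticFunction.liouville n : ℝ)|) ≤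
          η * (x : ℝ) / Real.log x ^ 2) :
    ∀ ε : ℝ, 0 < ε → ∀ᶠ x : ℕ in atTop,
      (∑ q ∈ primesIco (twinZ x) (twinY x),
        (roughMultCount ((twinSieveSet x).filter fun n => ArithmeticFunction.liouville n = -1)
          (twinZ x) q : ℝ)) ≤
        (Real.exp Real.eulerMascheroniConstant * Real.log 6 / 4 + ε) * twinMainTerm x := by
  intro ε hε
  set G := Real.exp Real.eulerMascheroniConstant with hG
  have hG0 : 0 < G := Real.exp_pos _
  have hlog6 : 0 < Real.log 6 := Real.log_pos (by norm_num)
  set a := G * Real.log 6 / 2 with ha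
  have ha0 : 0 < a := by positivity
  have haq : G * Real.log 6 / 4 = a / 2 := by rw [ha]; ring
  rw [haq]
  -- parameters and the deep inputs
  obtain ⟨h, hh0, hh1, hMAL⟩ := sum_primesIco_weight_le (show 0 < ε / (8 * G) by positivity)
  have hθ₁lt : 1 / 2 - h < 1 / 2 := by linarith
  obtain ⟨C, hC⟩ := eventually_sum_abs_primeCountingDisc_le BombieriVinogradovStatement_holds hθ₁lt
    (A := 5) (by norm_num)
  obtain ⟨B, hB, hCfun⟩ := Iwaniec1980_twisted_upper_of_half_lt (κ := (1 : ℝ)) (by norm_num)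
  obtain ⟨C₁, hC₁⟩ := hCfun (54 * Real.exp (54 / Real.log 2))
  set η₂ := ε / (4 * a + ε) with hη₂
  have hη₂0 : 0 < η₂ := by positivity
  set c₀ := 16 * Real.exp (-7) with hc₀
  have hc₀0 : 0 < c₀ := by positivity
  set C' := (2 * G + 2 + Real.exp 5) * max C 0 with hC'
  -- the oracle hypothesis at level `x^{1/2 - h}` with `η' = ε c₀/2`
  have hO := hΛ h hh0 (ε * c₀ / 2) (by positivity)
  -- eventualities
  have hE4 : ∀ᶠ x : ℕ in atTop, max C₁ 0 * (Real.log x / 8) ^ (-(1 / 3 : ℝ)) ≤ min (ε / 24) 1 := by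
    have h1 : Tendsto (fun x : ℕ => Real.log x / 8) atTop atTop :=
      (Real.tendsto_log_atTop.comp tendsto_natCast_atTop_atTop).atTop_div_const (by norm_num)
    have h2 : Tendsto (fun x : ℕ => (Real.log x / 8) ^ (-(1 / 3 : ℝ))) atTop (𝓝 0) :=
      (tendsto_rpow_neg_atTop (by norm_num : (0 : ℝ) < 1 / 3)).comp h1
    have h3 := h2.const_mul (max C₁ 0)
    rw [mul_zero] at h3
    exact h3.eventually_le_const (by positivity)
  have hE5 : ∀ᶠ x : ℕ in atTop, C' ≤ ε / 2 * c₀ * Real.log x ^ 2 := by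
    have h1 : Tendsto (fun x : ℕ => ε / 2 * c₀ * Real.log x ^ 2) atTop atTop := by
      refine Tendsto.const_mul_atTop (by positivity) ?_
      exact (tendsto_pow_atTop two_ne_zero).comp (Real.tendsto_log_atTop.comp tendsto_natCast_atTop_atTop)
    exact h1.eventually_ge_atTop C'
  filter_upwards [hMAL, hC, eventually_primeCounting_bounds hη₂0, eventually_twinY_le_rpow_third_add hh0,
    eventually_sum_primesIco_inv_sub_one_le, hE4, hE5, eventually_ge_atTop 6561, hO]
    with x hMALx hBVx hPNT hxy hS2 hEx hC'x hx hOx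
  -- basic facts about `x`
  have hx1 : (1 : ℝ) < x := by exact_mod_cast (show 1 < x by omega)
  have hx0 : (0 : ℝ) < x := by linarith
  have hLx : 0 < Real.log x := Real.log_pos hx1
  have hLx1 : 1 ≤ Real.log x := by
    have hx3 : (3 : ℝ) ≤ x := by exact_mod_cast (show 3 ≤ x by omega)
    rw [Real.le_log_iff_exp_le (by linarith)]
    exact (Real.exp_one_lt_d9.le.trans (by norm_num)).trans hx3
  have hx256 : (256 : ℝ) ≤ x := by exact_mod_cast (show 256 ≤ x by omega)
  have hx6561 : (6561 : ℝ) ≤ x := by exact_mod_cast hx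
  -- names
  set X := (x : ℝ) with hX
  set ℓ := Real.log X with hℓ
  set zr := X ^ (1 / 8 : ℝ) with hzr
  set D := X ^ (1 / 2 - h) with hD
  set V := sieveProduct 2 zr with hV
  set L := X / ℓ with hL
  set πx := (Nat.primeCounting x : ℝ) with hπx
  set Q := primesIco (twinZ x) (twinY x) with hQ
  set P := primesProdBelow zr with hP
  set E := max C₁ 0 * (ℓ / 8) ^ (-(1 / 3 : ℝ)) with hEdef
  set Sg := ∑ d ∈ P.divisors, shiftedPrimesDensity 2 d with hSg
  set SD := ∑ m ∈ Finset.Icc 1 ⌊X ^ (1 / 2 - h)⌋₊,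
    |primeCountingDisc m (negTwoUnit m : ZMod m) x| with hSD
  set SΛ := ∑ m ∈ Finset.Icc 1 ⌊X ^ (1 / 2 - h)⌋₊,
    |∑ n ∈ (twinSieveSet x).filter (fun n => m ∣ n), (ArithmeticFunction.liouville n : ℝ)| with hSΛ
  set A' := (twinSieveSet x).filter (fun n => ArithmeticFunction.liouville n = -1) with hA'
  -- facts about the parameters at `x`
  have hzr2 : 2 ≤ zr := by
    rw [hzr, show (2 : ℝ) = ((2 : ℝ) ^ (8 : ℕ)) ^ (1 / 8 : ℝ) by
      rw [← Real.rpow_natCast, ← Real.rpow_mul (by norm_num)]; norm_num]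
    exact Real.rpow_le_rpow (by norm_num) (by norm_num; exact hx256) (by norm_num)
  have hzr3 : 3 ≤ zr := by
    rw [hzr, show (3 : ℝ) = ((3 : ℝ) ^ (8 : ℕ)) ^ (1 / 8 : ℝ) by
      rw [← Real.rpow_natCast, ← Real.rpow_mul (by norm_num)]; norm_num]
    exact Real.rpow_le_rpow (by norm_num) (by norm_num; exact hx6561) (by norm_num)
  have hzr0 : 0 < zr := by linarith
  have hlogzr : Real.log zr = ℓ / 8 := by rw [hzr, Real.log_rpow hx0]; ring
  have hlogD : Real.log D = (1 / 2 - h) * ℓ := by rw [hD, Real.log_rpow hx0]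
  have hD0 : 0 < D := Real.rpow_pos_of_pos hx0 _
  have hVI : 0 ≤ V ∧ V ≤ 1 := sieveProduct_two_mem_Icc zr
  have hmainTerm : twinMainTerm x = L * V := by rw [twinMainTerm]
  have hLV : c₀ * X / ℓ ^ 2 ≤ L * V := by rw [← hmainTerm, hc₀]; exact twinMainTerm_ge hx
  have hL0 : 0 ≤ L := by positivity
  have hπle : πx ≤ (1 + η₂) * L := hPNT.2
  have hπ0 : 0 ≤ πx := Nat.cast_nonneg _
  have hE0 : 0 ≤ E := mul_nonneg (le_max_right _ _) (Real.rpow_nonneg (by positivity) _)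
  have hEε : E ≤ ε / 24 := hEx.trans (min_le_left _ _)
  have hE1 : E ≤ 1 := hEx.trans (min_le_right _ _)
  have hSg0 : 0 ≤ Sg := Finset.sum_nonneg fun d _ => by
    rw [shiftedPrimesDensity_apply]; split_ifs <;> positivity
  have hSgle : Sg ≤ Real.exp 5 * ℓ := by
    refine (sum_divisors_shiftedPrimesDensity_le hzr3).trans ?_
    rw [hlogzr]
    have : 0 ≤ Real.exp 5 * ℓ := mul_nonneg (Real.exp_pos 5).le hLx.le
    linarith only [this]
  have hSD0 : 0 ≤ SD := Finset.sum_nonneg fun m _ => abs_nonneg _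
  have hSDle : SD ≤ max C 0 * X / ℓ ^ 5 := by
    have h1 := hBVx negTwoUnit
    rw [show (5 : ℝ) = ((5 : ℕ) : ℝ) by norm_num, Real.rpow_natCast] at h1
    refine h1.trans ?_
    have : 0 ≤ X / ℓ ^ 5 := by positivity
    rw [mul_div_assoc, mul_div_assoc]
    exact mul_le_mul_of_nonneg_right (le_max_left _ _) this
  have hSΛ0 : 0 ≤ SΛ := Finset.sum_nonneg fun m _ => abs_nonneg _
  have hSΛle : SΛ ≤ ε / 2 * (L * V) := by
    refine hOx.trans ?_
    calc ε * c₀ / 2 * X / Real.log X ^ 2 = ε / 2 * (c₀ * X / ℓ ^ 2) := by rw [hℓ]; ring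
      _ ≤ ε / 2 * (L * V) := mul_le_mul_of_nonneg_left hLV (by positivity)
  have hyD : (twinY x : ℝ) ≤ D :=
    hxy.trans (Real.rpow_le_rpow_of_exponent_le hx1.le (by linarith))
  have hyzr : (twinY x : ℝ) * zr ≤ D := by
    calc (twinY x : ℝ) * zr ≤ X ^ (1 / 3 + h) * zr := mul_le_mul_of_nonneg_right hxy hzr0.le
      _ = X ^ (1 / 3 + h + 1 / 8) := by rw [hzr, ← Real.rpow_add hx0]
      _ ≤ D := Real.rpow_le_rpow_of_exponent_le hx1.le (by linarith)
  -- per-q facts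
  have hQfacts : ∀ q ∈ Q, q.Prime ∧ 3 ≤ q ∧ twinZ x ≤ q ∧ zr ≤ q ∧ (q : ℝ) < twinY x := by
    intro q hq
    rw [hQ, primesIco, Finset.mem_filter, Finset.mem_Ico] at hq
    have hzrq : zr ≤ q := twinZ_le_iff.mp hq.1.1
    have hq3 : 3 ≤ q := by
      have : (3 : ℝ) ≤ q := hzr3.trans hzrq
      exact_mod_cast this
    exact ⟨hq.2, hq3, hq.1.1, hzrq, by exact_mod_cast hq.1.2⟩
  -- the bound for one prime `q`: half the tree's bound plus half the oracle remainder
  have hperq : ∀ q ∈ Q, (roughMultCount A' (twinZ x) q : ℝ) ≤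
      (1 / 2) * (V * (πx * (G * (1 / ((q : ℝ) - 1) * ((1 / 4) / (1 / 2 - h - Real.log q / Real.log x))) +
          E * (1 / ((q : ℝ) - 1))) +
        (2 * G + E) * |primeCountingDisc q (negTwoUnit q : ZMod q) x|) +
      ((∑ d ∈ (Finset.range ⌈D / q⌉₊).filter (· ∣ P),
          |primeCountingDisc (q * d) (negTwoUnit (q * d) : ZMod (q * d)) x|) +
        Sg * |primeCountingDisc q (negTwoUnit q : ZMod q) x|)) +
      (1 / 2) * (∑ d ∈ (Finset.range ⌈D / q⌉₊).filter (· ∣ P),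
        |∑ n ∈ (twinSieveSet x).filter (fun n => q * d ∣ n), (ArithmeticFunction.liouville n : ℝ)|) := by
    intro q hq
    obtain ⟨hqp, hq3, hzq, hzrq, hqy⟩ := hQfacts q hq
    have hqodd : Odd q := hqp.odd_of_ne_two (by omega)
    have hq0 : (0 : ℝ) < q := by exact_mod_cast hqp.pos
    have hq3r : (3 : ℝ) ≤ q := by exact_mod_cast hq3
    have hq1 : (0 : ℝ) < (q : ℝ) - 1 := by linarith
    have hzq' : ⌈zr⌉₊ ≤ q := hzq
    set δq := primeCountingDisc q (negTwoUnit q : ZMod q) x with hδq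
    -- Iwaniec's theorem (twisted) for `𝒜_q` with level `D/q`
    have hzy : zr ≤ D / q := by
      rw [le_div_iff₀ hq0]
      calc zr * q ≤ zr * twinY x := mul_le_mul_of_nonneg_left hqy.le hzr0.le
        _ = twinY x * zr := mul_comm _ _
        _ ≤ D := hyzr
    have hsize : 0 ≤ (twinSeqMult x q).size ((x + 2 : ℕ) : ℝ) := Nat.cast_nonneg _
    have hb : ∀ n, 0 ≤ (twinWeightMult x q n -
        twinWeightMult x q n * (ArithmeticFunction.liouville n : ℝ)) / 2 := fun n => by
      have h1 := abs_liouville_le_one n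
      have h0 := twinWeightMult_nonneg x q n
      have : twinWeightMult x q n * (ArithmeticFunction.liouville n : ℝ) ≤ twinWeightMult x q n * 1 :=
        mul_le_mul_of_nonneg_left (le_of_abs_le h1) h0
      linarith
    have hbe : ∀ n, 2 * ((twinWeightMult x q n -
        twinWeightMult x q n * (ArithmeticFunction.liouville n : ℝ)) / 2) +
        twinWeightMult x q n * (ArithmeticFunction.liouville n : ℝ) ≤ (twinSeqMult x q).a n := fun n => by
      change _ ≤ twinWeightMult x q n
      linarith
    have hI := hC₁ (twinSeqMult x q) hasIwaniecDimension_shiftedPrimesDensity_two _ _ hb hbe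
      ((x + 2 : ℕ) : ℝ) (D / q) zr hzr2 hzy hsize
    rw [twistedSifted_twinSeqMult_eq, densityProduct_twinSeqMult_eq] at hI
    change (roughMultCount A' (twinZ x) q : ℝ) ≤ _ at hI
    -- the oracle remainder of `𝒜_q`
    have hREq : ∑ d ∈ (Finset.range ⌈D / q⌉₊).filter (· ∣ primesProdBelow zr),
        |∑ n ∈ (Finset.Ioc 0 ⌊((x + 2 : ℕ) : ℝ)⌋₊).filter (d ∣ ·),
          twinWeightMult x q n * (ArithmeticFunction.liouville n : ℝ)| =
        ∑ d ∈ (Finset.range ⌈D / q⌉₊).filter (· ∣ P),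
          |∑ n ∈ (twinSieveSet x).filter (fun n => q * d ∣ n), (ArithmeticFunction.liouville n : ℝ)| := by
      refine Finset.sum_congr rfl fun d hd => ?_
      rw [twistedCongrSum_twinSeqMult_eq (coprime_of_ceil_le_of_dvd_primesProdBelow hqp hzq'
        (Finset.mem_filter.mp hd).2)]
    rw [hREq] at hI
    -- the size `|𝒜_q| = π(x; q, -2) = δ(x; q) + π(x)/(q - 1)`
    have hsz : (twinSeqMult x q).size ((x + 2 : ℕ) : ℝ) = δq + πx / ((q : ℝ) - 1) := by
      change (#((twinSieveSet x).filter (fun n => q ∣ n)) : ℝ) = _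
      rw [card_filter_dvd_twinSieveSet hqodd hq3, primeCountingMod_negTwo_eq hqodd hq3,
        Nat.totient_prime hqp, Nat.cast_sub hqp.one_lt.le, Nat.cast_one]
    -- `s_q = log(D/q)/log zr = 8 (1/2 - h - t_q)` and `F(s_q) = 2e^γ/s_q`
    set tq := Real.log q / ℓ with htq
    have htq1 : 1 / 8 ≤ tq := by
      rw [htq, le_div_iff₀ hLx]
      have := Real.log_le_log hzr0 hzrq
      rw [hlogzr] at this
      linarith
    have htq2 : tq < 1 / 3 + h := by
      rw [htq, div_lt_iff₀ hLx]
      have h2 := Real.log_lt_log hq0 (hqy.trans_le hxy)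
      rwa [Real.log_rpow hx0] at h2
    have hsq : Real.log (D / q) / Real.log zr = 8 * (1 / 2 - h - tq) := by
      rw [Real.log_div hD0.ne' hq0.ne', hlogD, hlogzr, htq, div_eq_iff (by positivity)]
      field_simp
    have hgap : 1 / 8 < 1 / 2 - h - tq := by linarith
    have hsqpos : 0 < 8 * (1 / 2 - h - tq) := by linarith
    have hsq3 : 8 * (1 / 2 - h - tq) ≤ 3 := by linarith
    set wq := (1 / 4) / (1 / 2 - h - tq) with hwq
    have hw0 : 0 ≤ wq := div_nonneg (by norm_num) (by linarith)
    have hw2 : wq ≤ 2 := by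
      rw [hwq, div_le_iff₀ (by linarith)]; linarith
    have hF : B.1 (Real.log (D / q) / Real.log zr) = G * wq := by
      rw [hsq, hB.eqOn_iwaniecSieveFun.1 (Set.mem_Ioi.mpr hsqpos),
        iwaniecUpperSieveFun_one_eq_div ⟨hsqpos, hsq3⟩, rosserAdjointP_one_one, Real.exp_neg, ← hG,
        hwq]
      field_simp
      ring
    -- the error term `C₁ (log (D/q))^{-1/3} ≤ E`
    have herr : C₁ * Real.log (D / q) ^ (-(1 / 3 : ℝ)) ≤ E := by
      have hlogDq : Real.log zr ≤ Real.log (D / q) := Real.log_le_log hzr0 hzy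
      have hpos : 0 < Real.log zr := by rw [hlogzr]; positivity
      have h1 : Real.log (D / q) ^ (-(1 / 3 : ℝ)) ≤ Real.log zr ^ (-(1 / 3 : ℝ)) :=
        Real.rpow_le_rpow_of_nonpos hpos hlogDq (by norm_num)
      have h2 : 0 ≤ Real.log (D / q) ^ (-(1 / 3 : ℝ)) := Real.rpow_nonneg (hpos.le.trans hlogDq) _
      rw [hEdef, ← hlogzr]
      calc C₁ * Real.log (D / q) ^ (-(1 / 3 : ℝ)) ≤ max C₁ 0 * Real.log (D / q) ^ (-(1 / 3 : ℝ)) :=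
            mul_le_mul_of_nonneg_right (le_max_left _ _) h2
        _ ≤ max C₁ 0 * Real.log zr ^ (-(1 / 3 : ℝ)) := mul_le_mul_of_nonneg_left h1 (le_max_right _ _)
    have hcoef : B.1 (Real.log (D / q) / Real.log zr) + C₁ * Real.log (D / q) ^ (-(1 / 3 : ℝ)) ≤
        G * wq + E := by rw [hF]; linarith
    have hcoef0 : 0 ≤ G * wq + E := by positivity
    -- size bound and the main term
    have hszle : (twinSeqMult x q).size ((x + 2 : ℕ) : ℝ) ≤ πx / ((q : ℝ) - 1) + |δq| := by
      rw [hsz]; linarith [le_abs_self δq]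
    have hmain : (twinSeqMult x q).size ((x + 2 : ℕ) : ℝ) * V *
        (B.1 (Real.log (D / q) / Real.log zr) + C₁ * Real.log (D / q) ^ (-(1 / 3 : ℝ))) ≤
          (πx / ((q : ℝ) - 1) + |δq|) * V * (G * wq + E) := by
      have h1 : (twinSeqMult x q).size ((x + 2 : ℕ) : ℝ) * V *
          (B.1 (Real.log (D / q) / Real.log zr) + C₁ * Real.log (D / q) ^ (-(1 / 3 : ℝ))) ≤
            (twinSeqMult x q).size ((x + 2 : ℕ) : ℝ) * V * (G * wq + E) :=
        mul_le_mul_of_nonneg_left hcoef (mul_nonneg hsize hVI.1)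
      have h2 : (twinSeqMult x q).size ((x + 2 : ℕ) : ℝ) * V * (G * wq + E) ≤
          (πx / ((q : ℝ) - 1) + |δq|) * V * (G * wq + E) :=
        mul_le_mul_of_nonneg_right (mul_le_mul_of_nonneg_right hszle hVI.1) hcoef0
      linarith
    -- the remainder term
    have hR := remainderSum_twinSeqMult_le (x := x) (z := zr) (Y := D / q) hqp hq3 hzq
    -- combine
    have hGw : G * wq ≤ G * 2 := mul_le_mul_of_nonneg_left hw2 hG0.le
    have h3 : V * |δq| * (G * wq + E) ≤ V * |δq| * (2 * G + E) :=
      mul_le_mul_of_nonneg_left (by linarith only [hGw]) (mul_nonneg hVI.1 (abs_nonneg _))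
    have hid : (πx / ((q : ℝ) - 1) + |δq|) * V * (G * wq + E) =
        V * (πx * (G * (1 / ((q : ℝ) - 1) * wq) + E * (1 / ((q : ℝ) - 1)))) + V * |δq| * (G * wq + E) := by
      ring
    have hid2 : V * (πx * (G * (1 / ((q : ℝ) - 1) * wq) + E * (1 / ((q : ℝ) - 1))) + (2 * G + E) * |δq|) =
        V * (πx * (G * (1 / ((q : ℝ) - 1) * wq) + E * (1 / ((q : ℝ) - 1)))) + V * |δq| * (2 * G + E) := by
      ring
    rw [hid2]
    have hold : (twinSeqMult x q).size ((x + 2 : ℕ) : ℝ) * V *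
            (B.1 (Real.log (D / q) / Real.log zr) + C₁ * Real.log (D / q) ^ (-(1 / 3 : ℝ))) +
          ∑ d ∈ (Finset.range ⌈D / q⌉₊).filter (· ∣ P), |(twinSeqMult x q).remainder d ((x + 2 : ℕ) : ℝ)| ≤
        V * (πx * (G * (1 / ((q : ℝ) - 1) * wq) + E * (1 / ((q : ℝ) - 1)))) + V * |δq| * (2 * G + E) +
          ((∑ d ∈ (Finset.range ⌈D / q⌉₊).filter (· ∣ P),
              |primeCountingDisc (q * d) (negTwoUnit (q * d) : ZMod (q * d)) x|) + Sg * |δq|) := by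
      calc _ ≤ (πx / ((q : ℝ) - 1) + |δq|) * V * (G * wq + E) +
            ((∑ d ∈ (Finset.range ⌈D / q⌉₊).filter (· ∣ P),
                |primeCountingDisc (q * d) (negTwoUnit (q * d) : ZMod (q * d)) x|) + |δq| * Sg) :=
            add_le_add hmain hR
        _ ≤ _ := by rw [hid, mul_comm (|δq|) Sg]; linarith [h3]
    have hhalf := mul_le_mul_of_nonneg_left hold (by norm_num : (0 : ℝ) ≤ 1 / 2)
    linarith [hI, hhalf]
  -- sum over `q`
  have hsum := Finset.sum_le_sum hperq
  have hsplit : ∑ q ∈ Q, ((1 / 2) * (V * (πx * (G * (1 / ((q : ℝ) - 1) *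
          ((1 / 4) / (1 / 2 - h - Real.log q / Real.log x))) + E * (1 / ((q : ℝ) - 1))) +
        (2 * G + E) * |primeCountingDisc q (negTwoUnit q : ZMod q) x|) +
      ((∑ d ∈ (Finset.range ⌈D / q⌉₊).filter (· ∣ P),
          |primeCountingDisc (q * d) (negTwoUnit (q * d) : ZMod (q * d)) x|) +
        Sg * |primeCountingDisc q (negTwoUnit q : ZMod q) x|)) +
      (1 / 2) * (∑ d ∈ (Finset.range ⌈D / q⌉₊).filter (· ∣ P),
        |∑ n ∈ (twinSieveSet x).filter (fun n => q * d ∣ n), (ArithmeticFunction.liouville n : ℝ)|)) =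
      (1 / 2) * (V * πx * G * (∑ q ∈ Q, 1 / ((q : ℝ) - 1) * ((1 / 4) / (1 / 2 - h - Real.log q / Real.log x))) +
        V * πx * E * (∑ q ∈ Q, 1 / ((q : ℝ) - 1)) +
        (V * (2 * G + E) + Sg) * (∑ q ∈ Q, |primeCountingDisc q (negTwoUnit q : ZMod q) x|) +
        ∑ q ∈ Q, ∑ d ∈ (Finset.range ⌈D / q⌉₊).filter (· ∣ P),
          |primeCountingDisc (q * d) (negTwoUnit (q * d) : ZMod (q * d)) x|) +
      (1 / 2) * (∑ q ∈ Q, ∑ d ∈ (Finset.range ⌈D / q⌉₊).filter (· ∣ P),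
        |∑ n ∈ (twinSieveSet x).filter (fun n => q * d ∣ n), (ArithmeticFunction.liouville n : ℝ)|) := by
    simp only [Finset.sum_add_distrib, ← Finset.mul_sum]
    ring
  rw [hsplit] at hsum
  -- the five sums
  have hS1 : ∑ q ∈ Q, 1 / ((q : ℝ) - 1) * ((1 / 4) / (1 / 2 - h - Real.log q / Real.log x)) ≤
      Real.log 6 / 2 + ε / (8 * G) := hMALx
  have hS3 : ∑ q ∈ Q, |primeCountingDisc q (negTwoUnit q : ZMod q) x| ≤ SD := by
    refine Finset.sum_le_sum_of_subset_of_nonneg (fun q hq => ?_) fun m _ _ => abs_nonneg _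
    obtain ⟨hqp, -, -, -, hqy⟩ := hQfacts q hq
    rw [Finset.mem_Icc]
    refine ⟨hqp.one_lt.le, Nat.le_floor ?_⟩
    exact (hqy.le.trans hyD)
  have hS4 : ∑ q ∈ Q, ∑ d ∈ (Finset.range ⌈D / q⌉₊).filter (· ∣ P),
      |primeCountingDisc (q * d) (negTwoUnit (q * d) : ZMod (q * d)) x| ≤ SD :=
    sum_sum_abs_primeCountingDisc_le x (twinY x) zr D
  have hS5 : ∑ q ∈ Q, ∑ d ∈ (Finset.range ⌈D / q⌉₊).filter (· ∣ P),
      |∑ n ∈ (twinSieveSet x).filter (fun n => q * d ∣ n), (ArithmeticFunction.liouville n : ℝ)| ≤ SΛ :=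
    sum_primesIco_sum_le_sum_Icc (F := fun m =>
      |∑ n ∈ (twinSieveSet x).filter (fun n => m ∣ n), (ArithmeticFunction.liouville n : ℝ)|)
      (fun m => abs_nonneg _) (twinY x) zr D
  -- the main term
  have hVπ0 : 0 ≤ V * πx := mul_nonneg hVI.1 hπ0
  have hM1 : V * πx * G * (∑ q ∈ Q, 1 / ((q : ℝ) - 1) * ((1 / 4) / (1 / 2 - h - Real.log q / Real.log x))) ≤
      V * πx * G * (Real.log 6 / 2 + ε / (8 * G)) :=
    mul_le_mul_of_nonneg_left hS1 (by positivity)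
  have hM2 : V * πx * E * (∑ q ∈ Q, 1 / ((q : ℝ) - 1)) ≤ V * πx * E * 3 :=
    mul_le_mul_of_nonneg_left hS2 (by positivity)
  have hM3 : V * πx * G * (Real.log 6 / 2 + ε / (8 * G)) + V * πx * E * 3 ≤ V * πx * (a + ε / 4) := by
    have e1 : V * πx * G * (Real.log 6 / 2 + ε / (8 * G)) = V * πx * (a + ε / 8) := by
      rw [ha]; field_simp
    rw [e1]
    have h4 : V * πx * E ≤ V * πx * (ε / 24) := mul_le_mul_of_nonneg_left hEε hVπ0
    linarith only [h4]
  have hM4 : V * πx * (a + ε / 4) ≤ V * ((1 + η₂) * L) * (a + ε / 4) := by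
    have : V * πx ≤ V * ((1 + η₂) * L) := mul_le_mul_of_nonneg_left hπle hVI.1
    exact mul_le_mul_of_nonneg_right this (by positivity)
  have hM5 : V * ((1 + η₂) * L) * (a + ε / 4) = (a + ε / 2) * (L * V) := by
    have e2 : (1 + η₂) * (a + ε / 4) = a + ε / 2 := by
      rw [hη₂]; field_simp; ring
    calc V * ((1 + η₂) * L) * (a + ε / 4) = ((1 + η₂) * (a + ε / 4)) * (L * V) := by ring
      _ = (a + ε / 2) * (L * V) := by rw [e2]
  -- the junk
  have hJ1 : (V * (2 * G + E) + Sg) * (∑ q ∈ Q, |primeCountingDisc q (negTwoUnit q : ZMod q) x|) +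
      ∑ q ∈ Q, ∑ d ∈ (Finset.range ⌈D / q⌉₊).filter (· ∣ P),
        |primeCountingDisc (q * d) (negTwoUnit (q * d) : ZMod (q * d)) x| ≤
      (2 * G + 2 + Real.exp 5 * ℓ) * SD := by
    have h1 : V * (2 * G + E) + Sg ≤ 2 * G + 1 + Real.exp 5 * ℓ := by
      have : V * (2 * G + E) ≤ 1 * (2 * G + 1) := by
        refine mul_le_mul hVI.2 (by linarith) (by positivity) zero_le_one
      linarith
    have h2 := mul_le_mul h1 hS3 (Finset.sum_nonneg fun q _ => abs_nonneg _)
      (add_nonneg (by positivity) (mul_nonneg (Real.exp_pos 5).le hLx.le))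
    linarith only [h2, hS4]
  have hJ2 : (2 * G + 2 + Real.exp 5 * ℓ) * SD ≤ ε / 2 * (L * V) := by
    have h1 : 2 * G + 2 + Real.exp 5 * ℓ ≤ (2 * G + 2 + Real.exp 5) * ℓ := by
      have : 0 ≤ (2 * G + 2) * (ℓ - 1) := mul_nonneg (by positivity) (by linarith only [hLx1])
      linarith only [this]
    calc (2 * G + 2 + Real.exp 5 * ℓ) * SD ≤ ((2 * G + 2 + Real.exp 5) * ℓ) * (max C 0 * X / ℓ ^ 5) :=
          mul_le_mul h1 hSDle hSD0 (mul_nonneg (by positivity) hLx.le)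
      _ = C' * X / ℓ ^ 4 := by rw [hC']; field_simp
      _ ≤ (ε / 2 * c₀ * ℓ ^ 2) * X / ℓ ^ 4 := by gcongr
      _ = ε / 2 * (c₀ * X / ℓ ^ 2) := by field_simp
      _ ≤ ε / 2 * (L * V) := mul_le_mul_of_nonneg_left hLV (by positivity)
  -- conclusion
  have hLV0 : 0 ≤ L * V := mul_nonneg hL0 hVI.1
  rw [hmainTerm]
  linarith only [hsum, hM1, hM2, hM3, hM4, hM5, hJ1, hJ2, hS5, hSΛle, mul_nonneg hε.le hLV0]

end Summit.Parity.GeneralizedHardyLittlewood.Theorems
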